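import Mathlib

/-!
# Solo-blind O1b, E74: the maximal ideal of a local ring integral inside a product of local rings

Ring-theoretic core of PROPOSITION Φ11a of the solo-blind Eisenstein study
(`paper/theoremPhi.md` §5(n)): the local Hecke algebra `T = T^{new}(M)_𝔪` sits inside the product
`O = ∏ᵢ O_{Kᵢ}` of the valuation rings of its places and `O` is integral over `T`; hence
`𝔪_T = T ∩ rad O`, i.e. every element of `𝔪_T` has *every* coordinate in the maximal ideal of the
corresponding factor, so `T ⊆ ℤ_ℓ + rad O`.  Abstract form: for an integral ring map `f` from a
local ring `T` to a finite product of local rings, the contraction of each factor's maximal ideal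
is `𝔪_T`.
-/

namespace Summit.Langlands.Langlands.Theorems

/-- **E74a.** If `f : T →+* O` is an integral ring homomorphism between local rings, the maximal
ideal of `O` contracts to the maximal ideal of `T`. -/
theorem soloBlind_comap_maximalIdeal_eq_of_isIntegral
    {T O : Type*} [CommRing T] [IsLocalRing T] [CommRing O] [IsLocalRing O]
    (f : T →+* O) (hf : f.IsIntegral) :
    (IsLocalRing.maximalIdeal O).comap f = IsLocalRing.maximalIdeal T := by
  letI : Algebra T O := f.toAlgebra
  haveI : Algebra.IsIntegral T O := ⟨fun x => hf x⟩
  have hmax : ((IsLocalRing.maximalIdeal O).comap (algebraMap T O)).IsMaximal :=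
    Ideal.isMaximal_comap_of_isIntegral_of_isMaximal (IsLocalRing.maximalIdeal O)
  exact IsLocalRing.eq_maximalIdeal hmax

/-- **E74b (PROPOSITION Φ11a, abstract form).** Let `f : T →+* ∏ᵢ Oᵢ` be an integral ring
homomorphism from a local ring to a finite product of local rings.  Then for every factor `i`
the maximal ideal of `Oᵢ` contracts (through the `i`-th coordinate) to `𝔪_T`; in particular every
element of `𝔪_T` has all its coordinates in the respective maximal ideals. -/
theorem soloBlind_comap_maximalIdeal_pi_eq_of_isIntegral
    {ι : Type*} [Fintype ι] {O : ι → Type*} [∀ i, CommRing (O i)] [∀ i, IsLocalRing (O i)]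
    {T : Type*} [CommRing T] [IsLocalRing T]
    (f : T →+* (∀ i, O i)) (hf : f.IsIntegral) (i : ι) :
    (IsLocalRing.maximalIdeal (O i)).comap ((Pi.evalRingHom O i).comp f)
      = IsLocalRing.maximalIdeal T := by
  apply soloBlind_comap_maximalIdeal_eq_of_isIntegral
  exact RingHom.IsIntegral.trans f (Pi.evalRingHom O i) hf
    (RingHom.isIntegral_of_surjective _ (Function.surjective_eval i))

/-- **E74c.** Same setting: the image of `𝔪_T` lies in the Jacobson radical of the product,
coordinatewise. -/
theorem soloBlind_apply_mem_maximalIdeal_of_mem_maximalIdeal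
    {ι : Type*} [Fintype ι] {O : ι → Type*} [∀ i, CommRing (O i)] [∀ i, IsLocalRing (O i)]
    {T : Type*} [CommRing T] [IsLocalRing T]
    (f : T →+* (∀ i, O i)) (hf : f.IsIntegral) {x : T}
    (hx : x ∈ IsLocalRing.maximalIdeal T) (i : ι) :
    f x i ∈ IsLocalRing.maximalIdeal (O i) := by
  have h := soloBlind_comap_maximalIdeal_pi_eq_of_isIntegral f hf i
  rw [← h] at hx
  simpa [Ideal.mem_comap] using hx

end Summit.Langlands.Langlands.Theorems
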